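import Summits.HodgeConjecture.HodgeConjecture.Theorems.F0P3LieSpanClosureInvariant
import Summits.HodgeConjecture.HodgeConjecture.Theorems.F0P2aL2bHolArchSmooth
import Summits.HodgeConjecture.HodgeConjecture.Theorems.F0P2aL2bSliceContinuous
import Literature.NumberTheory.Automorphic.DiscreteSummandProjection
import HarnessLib

/-!
# Crux `H413` — RUNG 1½ «ISOTYPY FROM A NULL CORE», brick B3 (CM half): the closed `U(2,1)`-invariant subspace `C_Φ ⊆ P` generated by a
# holomorphic cotangent form `Φ` of the CM frame

Floor-0 programme P3 «U3-mult», seat F0P3-p02 (g3); crux item stmt-HodgeConjecture-24833 (`HCCMUnconditional.H413`); road «F1a in-house at the pin»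
(design note `F0/P3/STATUS.md` 2026-08-31T01:05Z; B1 ★ `F0P3GenIrreducibleOfUnitary`, B2 ★ `Literature/…/HarishChandraModuleIntertwiners`, B3-generic
★/pending `F0P3LieSpanClosureInvariant`).  HC_CM is proved only modulo the printed citations until rung 0 closes.

Setting: the CM frame `(L, ι, H, T, hT)` of the letters (`L` CM, `[L⁺:ℚ] ≥ 2`, `H` definite at the complex places `≠` that of `ι`, frame `T` of
signature `(2,1)` at `ι`), `𝒰 = adelicGroupData L⁺ L c̄ 3 H`, `(ιinf, K_c) = (cmArchSection, cmCompactFactor)`, automorphic `μ`, and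
`Φ ∈ holCotForms ιinf K_c`.  Let `V_Φ = span {Φ₀, Φ₁}` (the two coordinate functions), `S_Φ` its `𝔤`-span (iterated Lie derivatives along `ιinf`),
and `C_Φ` the `L²`-closure of the classes of `S_Φ` — written out in full below (no definition is introduced).

* `holClosure_package` — THE `W`-PACKAGE OF ★ `F0P2aArchOrthHol.archOrthHol_of_cuts` (F0P2a-p01) at the CM frame, with L2B-i/ii folded BY NAME
  (★ `F0P2aL2bHolArchSmooth.isArchSmooth_apply_of_mem_holCotForms_cm`, ★ `F0P2aL2bSliceContinuous.continuous_of_continuous_cmSlice`): the space `W` of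
  arch-smooth, left-`U(H)(L⁺)`-invariant, right-`K_c`/`K_f`-invariant functions is Lie-stable, `L²`-representable with injective class map, contains
  the coordinates of `Φ`; `V_Φ` is finite-dimensional, `𝔨`-stable (infinitesimal `K_∞`-type, ★ `lieDeriv_of_weight_eq`) and `𝔭⁻`-null (Cauchy–Riemann,
  ★ `lieDeriv_liePMat_I_smul_of_isHolGerm`).  CONSEQUENCES (B3-generic ★ `mem_closure_lieSpan_iff_rightRegular_mem`):
  - `rightRegular_mem_holClosure_iff` — **`C_Φ` is `R(ιinf u)`-STABLE for every `u ∈ U(2,1)`** (`y ∈ C_Φ ↔ R(ιinf u) y ∈ C_Φ`);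
  - `toLp_mem_holClosure` — the classes `[Φⱼ]` lie in `C_Φ`;
  - `holClosure_le_space` — **if `P.ContainsForm Φ` then `C_Φ ≤ P.space`**: the class of a Lie derivative `X φ` of `φ ∈ W` with `[φ] ∈ P` lies in `P`
    (it is the `L²`-derivative of `t ↦ R(ιinf exp tX)[φ] ∈ P`, ★ `hasDerivAt_rightRegular_expMem_toLp`; `P` is closed and `R`-stable, read through
    `pr_P`, ★ `DiscreteAutomorphicRep.starProjection_rightRegular`), so by induction all classes of `S_Φ` lie in `P`, and `P` is closed.
So `C_Φ` is a CLOSED `ιinf(U(2,1))`-INVARIANT SUBSPACE OF `P` containing `[Φ₀], [Φ₁]`: the `ClosedSubrep` of `P.archRep u21Group cmArchSection` on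
which brick B4 projects (★ `DiscreteAutomorphicRep.starProjection_archRep`).

No definition, no sorry, no named fact; `--supports stmt-HodgeConjecture-24833 --as helper`.

References: [HarishChandraTAMS1953] Cor. to Thm 2, Lemma 34, §9; [BorelJacquet1979] §4.1–4.6; [BorelWallach2000] VII 2.10, 3.2; [Borel1997] §5.14.
-/

set_option autoImplicit false
-- the mandated namespace repeats `HodgeConjecture.HodgeConjecture`, as in every `Theorems/*.lean` of this sub-problem
set_option linter.dupNamespace false

noncomputable section

open scoped Matrix MatrixGroups Topology InnerProductSpace ENNReal ComplexConjugate ComplexOrder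
open MeasureTheory NumberField Filter MulAction
open Literature.NumberTheory.Automorphic Literature.NumberTheory.Automorphic.UnitaryGroup
open Literature.NumberTheory.Automorphic.UnitaryGroup.CotangentForms (toQuotFun toQuotFun_mk cmArchSection cmCompactFactor holCotForms
  mem_holCotForms_iff)
open Literature.Geometry.ComplexHyperbolic Literature.Geometry.ComplexHyperbolic.BallModel
open Literature.AlgebraicGeometry.ShimuraVarieties Literature.AlgebraicGeometry.ShimuraVarieties.BallForms
open Summit.HodgeConjecture.HodgeConjecture.Cruxes.H413.SpectrumJunction
open Summit.HodgeConjecture.HodgeConjecture.Cruxes.H413.F0P2aArchOrthPrelim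
open Summit.HodgeConjecture.HodgeConjecture.Cruxes.H413.F0P2aCmFrameFactorisation
open Summit.HodgeConjecture.HodgeConjecture.Cruxes.H413.F0P2aArchOrthHol (lieDeriv_apply_mul_left lieDeriv_apply_mul_right lieSpan_le le_lieSpan
  lieDeriv_lincomb iterLieDeriv_mem_of_stable)
open Summit.HodgeConjecture.HodgeConjecture.Cruxes.H413.F0P2aL2bHolArchSmooth (isArchSmooth_apply_of_mem_holCotForms_cm)
open Summit.HodgeConjecture.HodgeConjecture.Cruxes.H413.F0P2aL2bSliceContinuous (continuous_of_continuous_cmSlice)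
open Summit.HodgeConjecture.HodgeConjecture.Cruxes.H413.F0P3LieSpanClosureInvariant

namespace Summit.HodgeConjecture.HodgeConjecture.Cruxes.H413.F0P3HolFormClosedSubrep

variable (L : Type) [Field L] [NumberField L] [IsCMField L] (ι : L →+* ℂ) (H : Matrix (Fin 3) (Fin 3) L) (T : GL (Fin 3) ℂ)
  (hT : (T : Matrix (Fin 3) (Fin 3) ℂ)ᴴ * H.map ι * (T : Matrix (Fin 3) (Fin 3) ℂ) = Literature.Geometry.ComplexHyperbolic.BallModel.J)

/-- **THE `W`-PACKAGE AND THE CLOSED INVARIANT SUBSPACE OF A HOLOMORPHIC COTANGENT FORM** (CM frame, `H` definite away from `ι`, `[L⁺:ℚ] ≥ 2`).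
For `Φ ∈ holCotForms (cmArchSection …) (cmCompactFactor …)` with `C_Φ` the `L²`-closure of the classes of the `𝔤`-span of `span {Φ₀, Φ₁}`:
(1) `y ∈ C_Φ ↔ R(cmArchSection u) y ∈ C_Φ` for all `u ∈ U(2,1)`; (2) the classes `[Φⱼ]` lie in `C_Φ`; (3) for every discrete `P` with `P.ContainsForm Φ`,
`C_Φ ≤ P.space`.  (The `W`-package of ★ `F0P2aArchOrthHol.archOrthHol_of_cuts` with L2B-i/ii, Nelson, HC-closure and exp-generation folded by name.)
[cite: HarishChandraTAMS1953, Cor. to Thm 2; Lemma 34] [cite: BorelJacquet1979, §4.6] [cite: BorelWallach2000, VII 3.2] -/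
theorem holClosure_package
    (hdef : ∀ τ' : L →+* ℂ, InfinitePlace.mk τ' ≠ InfinitePlace.mk ι → (H.map τ').PosDef) (h2 : 2 ≤ Module.finrank ℚ ↥(maximalRealSubfield L))
    (μ : Measure (adelicGroupData (↥(maximalRealSubfield L)) L (IsCMField.complexConj L) 3 H).automorphicQuotient)
    [(adelicGroupData (↥(maximalRealSubfield L)) L (IsCMField.complexConj L) 3 H).IsAutomorphicMeasure μ]
    {Φ : (adelicGroupData (↥(maximalRealSubfield L)) L (IsCMField.complexConj L) 3 H).Adelic → (Fin 2 → ℂ)}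
    (hΦ : Φ ∈ holCotForms (↥(maximalRealSubfield L)) L (IsCMField.complexConj L) 3 H (cmArchSection L ι H T hT) (cmCompactFactor L ι H T hT))
    (hm : ∀ j : Fin 2, MemLp (toQuotFun (adelicGroupData (↥(maximalRealSubfield L)) L (IsCMField.complexConj L) 3 H) fun x => Φ x j) 2 μ) :
    (∀ (u : U21) (y : (adelicGroupData (↥(maximalRealSubfield L)) L (IsCMField.complexConj L) 3 H).L2 μ),
      y ∈ (l2OfForms (adelicGroupData (↥(maximalRealSubfield L)) L (IsCMField.complexConj L) 3 H) μ (Submodule.span ℂ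
        {χ | ∃ (l : List u21Group.lie) (ψ : (adelicGroupData (↥(maximalRealSubfield L)) L (IsCMField.complexConj L) 3 H).Adelic → ℂ),
          ψ ∈ Submodule.span ℂ (Set.range fun j : Fin 2 => fun x => Φ x j) ∧ χ = iterLieDeriv (H := u21Group) (cmArchSection L ι H T hT) l ψ})).topologicalClosure ↔
      (adelicGroupData (↥(maximalRealSubfield L)) L (IsCMField.complexConj L) 3 H).rightRegular μ (cmArchSection L ι H T hT u) y ∈
        (l2OfForms (adelicGroupData (↥(maximalRealSubfield L)) L (IsCMField.complexConj L) 3 H) μ (Submodule.span ℂ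
        {χ | ∃ (l : List u21Group.lie) (ψ : (adelicGroupData (↥(maximalRealSubfield L)) L (IsCMField.complexConj L) 3 H).Adelic → ℂ),
          ψ ∈ Submodule.span ℂ (Set.range fun j : Fin 2 => fun x => Φ x j) ∧ χ = iterLieDeriv (H := u21Group) (cmArchSection L ι H T hT) l ψ})).topologicalClosure) ∧
    (∀ j : Fin 2, (hm j).toLp _ ∈
      (l2OfForms (adelicGroupData (↥(maximalRealSubfield L)) L (IsCMField.complexConj L) 3 H) μ (Submodule.span ℂ
        {χ | ∃ (l : List u21Group.lie) (ψ : (adelicGroupData (↥(maximalRealSubfield L)) L (IsCMField.complexConj L) 3 H).Adelic → ℂ),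
          ψ ∈ Submodule.span ℂ (Set.range fun j : Fin 2 => fun x => Φ x j) ∧ χ = iterLieDeriv (H := u21Group) (cmArchSection L ι H T hT) l ψ})).topologicalClosure) ∧
    (∀ P : DiscreteAutomorphicRep (adelicGroupData (↥(maximalRealSubfield L)) L (IsCMField.complexConj L) 3 H) μ, P.ContainsForm Φ →
      (l2OfForms (adelicGroupData (↥(maximalRealSubfield L)) L (IsCMField.complexConj L) 3 H) μ (Submodule.span ℂ
        {χ | ∃ (l : List u21Group.lie) (ψ : (adelicGroupData (↥(maximalRealSubfield L)) L (IsCMField.complexConj L) 3 H).Adelic → ℂ),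
          ψ ∈ Submodule.span ℂ (Set.range fun j : Fin 2 => fun x => Φ x j) ∧ χ = iterLieDeriv (H := u21Group) (cmArchSection L ι H T hT) l ψ})).topologicalClosure ≤
      P.space.toSubmodule) := by
  -- the archimedean section and the compact quotient
  let ιA : ↥U21 →* (adelicGroupData (↥(maximalRealSubfield L)) L (IsCMField.complexConj L) 3 H).Adelic := cmArchSection L ι H T hT
  have hιA : Continuous ιA := continuous_archSectionU21CM L ι H T hT
  have h4 : 4 ≤ Module.finrank ℚ L := by
    have h := Module.finrank_mul_finrank ℚ ↥(maximalRealSubfield L) L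
    rw [Algebra.IsQuadraticExtension.finrank_eq_two ↥(maximalRealSubfield L) L] at h
    omega
  obtain ⟨τ, hτ⟩ := exists_infinitePlace_ne L h4 ι
  haveI : CompactSpace (adelicGroupData (↥(maximalRealSubfield L)) L (IsCMField.complexConj L) 3 H).automorphicQuotient :=
    compactSpace_cmDatum_automorphicQuotient_of_posDef L 3 H τ (hdef τ hτ)
  -- commutation of `ι_∞(U(2,1))` with `K_c` and with `U(H)(𝔸_f)`
  have hcommK : ∀ k ∈ cmCompactFactor L ι H T hT, ∀ u' : ↥U21, ιA u' * k = k * ιA u' := fun k hk u' =>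
    cmArchSection_mul_of_mem_cmCompactFactor L ι H T hT u' hk
  have hcommF : ∀ (g : finAdelic (↥(maximalRealSubfield L)) L (IsCMField.complexConj L) 3 H) (u' : ↥U21),
      ιA u' * finAdelicToAdelic (↥(maximalRealSubfield L)) L (IsCMField.complexConj L) 3 H g =
        finAdelicToAdelic (↥(maximalRealSubfield L)) L (IsCMField.complexConj L) 3 H g * ιA u' := fun g u' =>
    cmArchSection_mul_finAdelicToAdelic L ι H T hT u' g
  -- the space `W` of smooth, left-invariant, `K_c`- and `K_f`-invariant functions (★ `archOrthHol_of_cuts`, verbatim)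
  let W : Submodule ℂ ((adelicGroupData (↥(maximalRealSubfield L)) L (IsCMField.complexConj L) 3 H).Adelic → ℂ) :=
    { carrier := {ψ | IsArchSmooth (H := u21Group) ιA ψ ∧
        (∀ γ ∈ (adelicGroupData (↥(maximalRealSubfield L)) L (IsCMField.complexConj L) 3 H).quotientSubgroup, ∀ g, ψ (γ * g) = ψ g) ∧
        (∀ k ∈ cmCompactFactor L ι H T hT, ∀ x, ψ (x * k) = ψ x) ∧
        ∃ Kf : Subgroup (finAdelic (↥(maximalRealSubfield L)) L (IsCMField.complexConj L) 3 H),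
          IsOpen (Kf : Set (finAdelic (↥(maximalRealSubfield L)) L (IsCMField.complexConj L) 3 H)) ∧
          ∀ k ∈ Kf, ∀ x, ψ (x * finAdelicToAdelic (↥(maximalRealSubfield L)) L (IsCMField.complexConj L) 3 H k) = ψ x}
      add_mem' := by
        rintro ψ ψ' ⟨h1, h2, h3, Kf, hKf, h4⟩ ⟨h1', h2', h3', Kf', hKf', h4'⟩
        refine ⟨IsArchSmooth.add (H := u21Group) ιA h1 h1', fun γ hγ g => ?_, fun k hk x => ?_, Kf ⊓ Kf', ?_, fun k hk x => ?_⟩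
        · simp only [Pi.add_apply, h2 γ hγ g, h2' γ hγ g]
        · simp only [Pi.add_apply, h3 k hk x, h3' k hk x]
        · rw [Subgroup.coe_inf]; exact hKf.inter hKf'
        · simp only [Pi.add_apply, h4 k hk.1 x, h4' k hk.2 x]
      zero_mem' := ⟨(archSmooth (H := u21Group) ιA).zero_mem, fun _ _ _ => rfl, fun _ _ _ => rfl, ⊤, isOpen_univ, fun _ _ _ => rfl⟩
      smul_mem' := by
        rintro a ψ ⟨h1, h2, h3, Kf, hKf, h4⟩
        refine ⟨IsArchSmooth.smul (H := u21Group) ιA a h1, fun γ hγ g => ?_, fun k hk x => ?_, Kf, hKf, fun k hk x => ?_⟩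
        · simp only [Pi.smul_apply, h2 γ hγ g]
        · simp only [Pi.smul_apply, h3 k hk x]
        · simp only [Pi.smul_apply, h4 k hk x] }
  have hWmem : ∀ {ψ}, ψ ∈ W ↔ IsArchSmooth (H := u21Group) ιA ψ ∧
        (∀ γ ∈ (adelicGroupData (↥(maximalRealSubfield L)) L (IsCMField.complexConj L) 3 H).quotientSubgroup, ∀ g, ψ (γ * g) = ψ g) ∧
        (∀ k ∈ cmCompactFactor L ι H T hT, ∀ x, ψ (x * k) = ψ x) ∧
        ∃ Kf : Subgroup (finAdelic (↥(maximalRealSubfield L)) L (IsCMField.complexConj L) 3 H),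
          IsOpen (Kf : Set (finAdelic (↥(maximalRealSubfield L)) L (IsCMField.complexConj L) 3 H)) ∧
          ∀ k ∈ Kf, ∀ x, ψ (x * finAdelicToAdelic (↥(maximalRealSubfield L)) L (IsCMField.complexConj L) 3 H k) = ψ x :=
    Iff.rfl
  have hsm : ∀ φ ∈ W, IsArchSmooth (H := u21Group) ιA φ := fun φ hφ => (hWmem.1 hφ).1
  have hleft : ∀ φ ∈ W, ∀ γ ∈ (adelicGroupData (↥(maximalRealSubfield L)) L (IsCMField.complexConj L) 3 H).quotientSubgroup,
      ∀ g, φ (γ * g) = φ g := fun φ hφ => (hWmem.1 hφ).2.1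
  have hlie : ∀ X : u21Group.lie, ∀ φ ∈ W, lieDeriv (H := u21Group) ιA X φ ∈ W := by
    intro X φ hφ
    obtain ⟨h1, h2, h3, Kf, hKf, h4⟩ := hWmem.1 hφ
    refine hWmem.2 ⟨isArchSmooth_lieDeriv_of_isArchSmooth (H := u21Group) ιA X h1, fun γ hγ g => ?_, fun k hk x => ?_, Kf, hKf,
      fun k hk x => ?_⟩
    · exact lieDeriv_apply_mul_left ιA X φ γ g (h2 γ hγ)
    · exact lieDeriv_apply_mul_right ιA X φ x k (fun u' => hcommK k hk u') (h3 k hk)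
    · exact lieDeriv_apply_mul_right ιA X φ x _ (fun u' => hcommF k u') (h4 k hk)
  have hcont : ∀ φ ∈ W, Continuous φ := fun φ hφ =>
    continuous_of_continuous_cmSlice L ι H T hT φ (continuous_slice_of_isArchSmooth ιA (hWmem.1 hφ).1) (hWmem.1 hφ).2.2.1 (hWmem.1 hφ).2.2.2
  have hinvQ : ∀ φ ∈ W, invQuot _ (toQuotFun (adelicGroupData (↥(maximalRealSubfield L)) L (IsCMField.complexConj L) 3 H) φ) = φ :=
    fun φ hφ => funext fun g => by rw [invQuot_apply, ← apply_eq_toQuotFun (hleft φ hφ) g]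
  have hmemLp : ∀ φ ∈ W, MemLp (toQuotFun (adelicGroupData (↥(maximalRealSubfield L)) L (IsCMField.complexConj L) 3 H) φ) 2 μ :=
    fun φ hφ => memLp_toQuotFun (hleft φ hφ) (hcont φ hφ) 2
  have hrep : W ≤ (adelicGroupData (↥(maximalRealSubfield L)) L (IsCMField.complexConj L) 3 H).l2Representable μ := fun φ hφ =>
    ⟨_, hmemLp φ hφ, hinvQ φ hφ⟩
  have hinj : ∀ (φ : (adelicGroupData (↥(maximalRealSubfield L)) L (IsCMField.complexConj L) 3 H).Adelic → ℂ) (hφ : φ ∈ W),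
      (adelicGroupData (↥(maximalRealSubfield L)) L (IsCMField.complexConj L) 3 H).l2ClassOf μ ⟨φ, hrep hφ⟩ = 0 → φ = 0 := by
    intro φ hφ h0
    rw [AdelicGroupData.l2ClassOf_eq (hmemLp φ hφ) (hinvQ φ hφ)] at h0
    by_contra hne
    exact toLp_toQuotFun_ne_zero (hleft φ hφ) (hcont φ hφ) (hmemLp φ hφ) hne h0
  -- the coordinates of `Φ` lie in `W`
  have hΦ' := mem_holCotForms_iff.1 hΦ
  have hΦW : ∀ i : Fin 2, (fun x => Φ x i) ∈ W := by
    intro i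
    obtain ⟨Kf, hKf, hfix⟩ := exists_isOpen_forall_apply_mul_eq_of_mem_smoothFun hΦ'.2.2.1
    refine hWmem.2 ⟨isArchSmooth_apply_of_mem_holCotForms_cm L ι H T hT hΦ i, fun γ hγ g => ?_, fun k hk x => ?_, Kf, hKf, fun k hk x => ?_⟩
    · simp only [leftInvariant_of_mem_holCotForms hΦ γ hγ g]
    · simp only [hΦ'.2.1 k hk x]
    · simp only [hfix k hk x]
  have hKΦ : ∀ (k : stabilizer (↥U21) x₀) (g : (adelicGroupData (↥(maximalRealSubfield L)) L (IsCMField.complexConj L) 3 H).Adelic),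
      Φ (g * ιA k) = (isPullbackCocycle_cotangentCocycle.weightOf x₀) k⁻¹ (Φ g) := fun k g => hΦ'.1.2 k g
  have hgerm : CotangentForms.IsHolGerm ιA Φ := hΦ'.2.2.2
  -- the span `V` of the coordinates: finite-dimensional, `𝔨`-stable, `𝔭⁻`-null
  set V : Submodule ℂ ((adelicGroupData (↥(maximalRealSubfield L)) L (IsCMField.complexConj L) 3 H).Adelic → ℂ) :=
    Submodule.span ℂ (Set.range fun j : Fin 2 => fun x => Φ x j) with hV_def
  have hVj : ∀ i : Fin 2, (fun x => Φ x i) ∈ V := fun i => Submodule.subset_span ⟨i, rfl⟩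
  have hVW : V ≤ W := Submodule.span_le.2 (by rintro _ ⟨i, rfl⟩; exact hΦW i)
  haveI hVfin : FiniteDimensional ℂ V := FiniteDimensional.span_of_finite ℂ (Set.finite_range _)
  -- elements of `V` are the combinations `a • Φ₀ + b • Φ₁`
  have hVmem : ∀ {φ}, φ ∈ V → ∃ a b : ℂ, φ = a • (fun x => Φ x 0) + b • (fun x => Φ x 1) := by
    intro φ hφ
    have hset : (Set.range fun j : Fin 2 => fun x => Φ x j) = {fun x => Φ x 0, fun x => Φ x 1} := by
      ext ψ
      simp only [Set.mem_range, Set.mem_insert_iff, Set.mem_singleton_iff]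
      constructor
      · rintro ⟨i, rfl⟩
        fin_cases i
        · exact Or.inl rfl
        · exact Or.inr rfl
      · rintro (rfl | rfl)
        · exact ⟨0, rfl⟩
        · exact ⟨1, rfl⟩
    rw [hV_def, hset] at hφ
    obtain ⟨a, b, rfl⟩ := Submodule.mem_span_pair.1 hφ
    exact ⟨a, b, rfl⟩
  have hsm0 : IsArchSmooth (H := u21Group) ιA (fun x => Φ x 0) := hsm _ (hΦW 0)
  have hsm1 : IsArchSmooth (H := u21Group) ιA (fun x => Φ x 1) := hsm _ (hΦW 1)
  have hlin : ∀ (X : u21Group.lie) (a b : ℂ), lieDeriv (H := u21Group) ιA X (a • (fun x => Φ x 0) + b • (fun x => Φ x 1)) =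
      a • lieDeriv (H := u21Group) ιA X (fun x => Φ x 0) + b • lieDeriv (H := u21Group) ιA X (fun x => Φ x 1) := fun X a b =>
    lieDeriv_lincomb ιA X hsm0 hsm1 a b
  have hVk : ∀ Y : u21Group.lie, (Y : Matrix (Fin 3) (Fin 3) ℂ) ∈ u21Group.compactLie →
      ∀ φ ∈ V, lieDeriv (H := u21Group) ιA Y φ ∈ V := by
    intro Y hY φ hφ
    have hYJ : (Y : Matrix (Fin 3) (Fin 3) ℂ) * J = J * (Y : Matrix (Fin 3) (Fin 3) ℂ) := (J_mul_eq_mul_J_of_mem_compactLie hY).symm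
    have hgen : ∀ i : Fin 2, lieDeriv (H := u21Group) ιA Y (fun x => Φ x i) ∈ V := by
      intro i
      have hfun : lieDeriv (H := u21Group) ιA Y (fun x => Φ x i) =
          -((Y : Matrix (Fin 3) (Fin 3) ℂ) 2 2) • (fun x => Φ x i) -
            ∑ i' : Fin 2, conj ((Y : Matrix (Fin 3) (Fin 3) ℂ) (Fin.castSucc i) (Fin.castSucc i')) • (fun x => Φ x i') := by
        funext x
        rw [lieDeriv_of_weight_eq ιA Φ hKΦ Y hYJ x i]
        simp only [Pi.sub_apply, Pi.smul_apply, Finset.sum_apply, smul_eq_mul]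
      rw [hfun]
      exact V.sub_mem (V.smul_mem _ (hVj i)) (V.sum_mem fun i' _ => V.smul_mem _ (hVj i'))
    obtain ⟨a, b, rfl⟩ := hVmem hφ
    rw [hlin]
    exact V.add_mem (V.smul_mem _ (hgen 0)) (V.smul_mem _ (hgen 1))
  have hVcr : ∀ φ ∈ V, ∀ b : Fin 2 → ℂ, lieDeriv (H := u21Group) ιA (liePMat (Complex.I • b)) φ =
      Complex.I • lieDeriv (H := u21Group) ιA (liePMat b) φ := by
    intro φ hφ b
    obtain ⟨a, a', rfl⟩ := hVmem hφ
    rw [hlin, hlin, lieDeriv_liePMat_I_smul_of_isHolGerm hgerm b 0, lieDeriv_liePMat_I_smul_of_isHolGerm hgerm b 1,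
      smul_add, smul_comm a, smul_comm a']
  refine ⟨fun u y => ?_, fun j => ?_, fun P hP => ?_⟩
  · -- (1) invariance: B3-generic
    exact mem_closure_lieSpan_iff_rightRegular_mem ιA hιA W hsm hlie hrep hinj V hVW hVk Complex.I_mul_I hVcr u y
  · -- (2) the classes of the coordinates
    exact toLp_mem_closure_lieSpan_of_mem ιA V (hm j) (by rw [hinvQ _ (hΦW j)]; exact hVj j)
  · -- (3) containment in `P.space`: classes of Lie derivatives of members of `W` with class in `P` stay in `P`
    have hprP : ∀ f : (adelicGroupData (↥(maximalRealSubfield L)) L (IsCMField.complexConj L) 3 H).L2 μ,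
        f ∈ P.space.toSubmodule ↔ P.space.toSubmodule.starProjection f = f := fun f =>
      (Submodule.starProjection_eq_self_iff).symm
    -- the archimedean-only automorphy datum `(u21Group, ιA)` (for ★ `hasDerivAt_rightRegular_expMem_toLp`)
    let 𝒟 : AutomorphyDatum (adelicGroupData (↥(maximalRealSubfield L)) L (IsCMField.complexConj L) 3 H) ℂ (Fin 3) :=
      { arch := u21Group
        ofArch := ιA
        continuous_ofArch := hιA
        finiteAdelic := ⊥
        commute_ofArch := fun g h hh => by
          rw [Subgroup.mem_bot] at hh
          rw [hh, mul_one, one_mul]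
        finiteLevels := {⊥}
        finiteLevels_nonempty := ⟨⊥, rfl⟩
        le_finiteAdelic := fun U hU => by
          rw [Set.mem_singleton_iff] at hU
          rw [hU]
        height := 0 }
    have hstep : ∀ φ (hφ : φ ∈ W) (X : u21Group.lie),
        (hmemLp φ hφ).toLp _ ∈ P.space.toSubmodule → (hmemLp _ (hlie X φ hφ)).toLp _ ∈ P.space.toSubmodule := by
      intro φ hφ X hφP
      have hd : HasDerivAt (fun t : ℝ => (adelicGroupData (↥(maximalRealSubfield L)) L (IsCMField.complexConj L) 3 H).rightRegular μ
            (ιA (u21Group.expMem (t • X))) ((hmemLp φ hφ).toLp _)) ((hmemLp _ (hlie X φ hφ)).toLp _) 0 :=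
        hasDerivAt_rightRegular_expMem_toLp 𝒟 (hmemLp φ hφ) (hmemLp _ (hlie X φ hφ))
          (by rw [hinvQ φ hφ]; exact hsm φ hφ) X (by rw [hinvQ φ hφ, hinvQ _ (hlie X φ hφ)])
      -- `pr_P` commutes with `R` and fixes the curve, hence its derivative
      have hd' : HasDerivAt (fun t : ℝ => (adelicGroupData (↥(maximalRealSubfield L)) L (IsCMField.complexConj L) 3 H).rightRegular μ
            (ιA (u21Group.expMem (t • X))) ((hmemLp φ hφ).toLp _))
          (P.space.toSubmodule.starProjection ((hmemLp _ (hlie X φ hφ)).toLp _)) 0 := by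
        have h := ((P.space.toSubmodule.starProjection.restrictScalars ℝ).hasFDerivAt).comp_hasDerivAt (0 : ℝ) hd
        have hfun : ((P.space.toSubmodule.starProjection.restrictScalars ℝ :
              (adelicGroupData (↥(maximalRealSubfield L)) L (IsCMField.complexConj L) 3 H).L2 μ →
                (adelicGroupData (↥(maximalRealSubfield L)) L (IsCMField.complexConj L) 3 H).L2 μ) ∘
            fun t : ℝ => (adelicGroupData (↥(maximalRealSubfield L)) L (IsCMField.complexConj L) 3 H).rightRegular μ
              (ιA (u21Group.expMem (t • X))) ((hmemLp φ hφ).toLp _)) =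
            fun t : ℝ => (adelicGroupData (↥(maximalRealSubfield L)) L (IsCMField.complexConj L) 3 H).rightRegular μ
              (ιA (u21Group.expMem (t • X))) ((hmemLp φ hφ).toLp _) := by
          funext t
          simp only [Function.comp_apply, ContinuousLinearMap.coe_restrictScalars']
          rw [DiscreteAutomorphicRep.starProjection_rightRegular, (hprP _).1 hφP]
        rw [hfun] at h
        exact h
      rw [hprP]
      exact (hd.unique hd').symm
    -- all iterated Lie derivatives of elements of `V` have classes in `P`
    have hiter : ∀ (l : List u21Group.lie) (ψ) (hψ : ψ ∈ V),
        (hmemLp _ (iterLieDeriv_mem_of_stable ιA hlie l (hVW hψ))).toLp _ ∈ P.space.toSubmodule := by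
      intro l
      induction l with
      | nil =>
        intro ψ hψ
        -- `ψ = a Φ₀ + b Φ₁`, classes of `Φⱼ` in `P`
        obtain ⟨a, b, hab⟩ := hVmem hψ
        obtain ⟨h0, hP0⟩ := hP 0
        obtain ⟨h1, hP1⟩ := hP 1
        have heq : (hmemLp _ (iterLieDeriv_mem_of_stable ιA hlie [] (hVW hψ))).toLp _ =
            a • h0.toLp (toQuotFun _ fun x => Φ x 0) + b • h1.toLp (toQuotFun _ fun x => Φ x 1) := by
          rw [← MemLp.toLp_const_smul, ← MemLp.toLp_const_smul, ← MemLp.toLp_add]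
          exact MemLp.toLp_congr _ _ (Filter.EventuallyEq.of_eq (by simp only [iterLieDeriv_nil, hab]; rfl))
        rw [heq]
        exact P.space.toSubmodule.add_mem (P.space.toSubmodule.smul_mem _ hP0) (P.space.toSubmodule.smul_mem _ hP1)
      | cons X l ih =>
        intro ψ hψ
        have h := hstep _ (iterLieDeriv_mem_of_stable ιA hlie l (hVW hψ)) X (ih ψ hψ)
        exact h
    -- hence the classes of the `𝔤`-span lie in `P`, and `P` is closed
    refine closure_lieSpan_le_of_l2OfForms_le ιA V P.space.isClosed' ?_
    rintro _ ⟨f, hf, rfl, hfS⟩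
    -- `f = toQuotFun φ` with `φ = invQuot f ∈ S ≤ W`
    have hφW : invQuot _ f ∈ W := lieSpan_le ιA hVW hlie hfS
    have hfeq : f = toQuotFun _ (invQuot _ f) := invQuot_injective _ ((hinvQ _ hφW).symm ▸ rfl)
    have key : ∀ φ, φ ∈ Submodule.span ℂ
        {χ | ∃ (l : List u21Group.lie) (ψ : (adelicGroupData (↥(maximalRealSubfield L)) L (IsCMField.complexConj L) 3 H).Adelic → ℂ),
          ψ ∈ V ∧ χ = iterLieDeriv (H := u21Group) ιA l ψ} →
        ∀ (hφ : φ ∈ W), (hmemLp φ hφ).toLp _ ∈ P.space.toSubmodule := by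
      intro φ hφS
      induction hφS using Submodule.span_induction with
      | mem x hx =>
        intro hxW
        obtain ⟨l, ψ, hψ, rfl⟩ := hx
        exact hiter l ψ hψ
      | zero =>
        intro h0
        have : (hmemLp 0 h0).toLp _ = 0 := by
          have e : (hmemLp 0 h0).toLp _ =
              (MemLp.zero : MemLp (0 : (adelicGroupData (↥(maximalRealSubfield L)) L (IsCMField.complexConj L) 3 H).automorphicQuotient → ℂ) 2 μ).toLp 0 :=
            MemLp.toLp_congr _ _ (Filter.EventuallyEq.of_eq rfl)
          rw [e]
          exact MemLp.toLp_zero _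
        rw [this]; exact P.space.toSubmodule.zero_mem
      | add x y hx hy ihx ihy =>
        intro hxy
        have hxW : x ∈ W := lieSpan_le ιA hVW hlie hx
        have hyW : y ∈ W := lieSpan_le ιA hVW hlie hy
        have : (hmemLp _ hxy).toLp _ = (hmemLp x hxW).toLp _ + (hmemLp y hyW).toLp _ := by
          rw [← MemLp.toLp_add]
          exact MemLp.toLp_congr _ _ (Filter.EventuallyEq.of_eq rfl)
        rw [this]; exact P.space.toSubmodule.add_mem (ihx hxW) (ihy hyW)
      | smul a x hx ihx =>
        intro hax
        have hxW : x ∈ W := lieSpan_le ιA hVW hlie hx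
        have : (hmemLp _ hax).toLp _ = a • (hmemLp x hxW).toLp _ := by
          rw [← MemLp.toLp_const_smul]
          exact MemLp.toLp_congr _ _ (Filter.EventuallyEq.of_eq rfl)
        rw [this]; exact P.space.toSubmodule.smul_mem _ (ihx hxW)
    have hclass : hf.toLp f = (hmemLp _ hφW).toLp _ := by
      exact MemLp.toLp_congr _ _ (Filter.EventuallyEq.of_eq (by rw [← hfeq]))
    rw [hclass]
    exact key _ hfS hφW

end Summit.HodgeConjecture.HodgeConjecture.Cruxes.H413.F0P3HolFormClosedSubrep

end
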